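import Summits.Ventures.GridStability.Bench.WSCC9Deg4ASosgramDinstRoaModel
import Summits.Ventures.GridStability.Bench.WSCC9Deg4ASosgramDinstBall
import HarnessLib

/-!
# «G1.WSCC9+ deg-4 (D-instance)» — rider «WSCC9-DEG4 BALL» (model half): a Euclidean ball of MACHINE STATES of the 3-machine
# WSCC9 model around the post-fault equilibrium inside the degree-4 certified region, with the ROA sentence from it

Venture GRIDFUSION, cell `gridfusion`; seat gridfusion-lyap-2 (g3); LOW rider (pattern of «#50′ BALL»). Sibling of `WSCC9Deg4ASosgramDinstBall.lean`
(recast half: weighted ball `Σ(σ² + κ²) + Σω²/64 ≤ (241/1000)²` ∩ {h = 0} ⊆ {V₄ ≤ 1159/1000}, ONE `decide` on `Lyapunov/PolyRecastBox`)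
and of #62's `WSCC9Deg4ASosgramDinstRoaModel.lean` (`…_model_roa`), which it imports; embedding vocabulary = lyap-1's `deg2_A_SPdampH12_Z δs x =
(sin u₂, 1 − cos u₂, sin u₃, 1 − cos u₃, ω₁, ω₂, ω₃)` and #62's `…_Z_mem_M`. New facts: `sin²u + (1 − cos u)² ≤ u²` per relative
angle (`…_ballsum_Z_le`) and the packaging.

STATEMENT (`deg4_A_sosgram_Dinst_model_roa_ball`): for equilibrium angles `δs` with `WSCC9.postB_SPdamp.EqData δs` and every solution `c` of
`WSCC9.postB_SPdamp.toModel` on `[0, ∞)` whose INITIAL MACHINE STATE satisfies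
`u₂(0)² + u₃(0)² + (ω₁(0)² + ω₂(0)² + ω₃(0)²)/64 ≤ (241/1000)²` (`u_i` = rotor-angle deviation of machine `i` relative to machine 1 from
the equilibrium, `ω_j` = speed deviation in rad/s; e.g. ONE relative angle displaced by ≤ 0.241 rad = 13.8°, or both by ≤ 9.8°, or one
machine speed deviation ≤ 1.93 rad/s): `V₄ ≤ 1159/1000` along the recast state for all `t ≥ 0`, no relative angle ever reaches `±π`
(no pole slip), every `u_i(t) → 0` and every `ω_j(t) → 0`. The window hypothesis `|u_i(0)| < π` of `…_model_roa` is discharged by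
the ball. Existence of the global solution is lyap-2 g0's `ClassicalSwingGlobal.postB_SPdamp_exists_solution` (not restated).

THREE COLUMNS. CERTIFIED (kernel): the inclusion of the ball in the certified piece (recast half) + this packaging. MODELLED: as the
parent row «G1.WSCC9+ deg-4 (D-instance)» (model-1's `WSCC9.postB_SPdamp.toModel`: Anderson–Fouad / Sauer–Pai classical 3-machine
9-bus model, post-fault-B Kron reduction with transfer conductances, uniform-ratio damping DECLARED; MV-2+MV-P+MV-SPD+MV-ω+MV-h12).
VALIDATED: nothing here. No sentence here says a grid is stable; the ball is a set of initial states OF THE MODEL M′, a crude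
(coefficient-majorant) inner description of the certified region.
-/

namespace Summit.Ventures.GridStability.Bench.WSCC9

open Set Filter Metric Topology Real
open Summit.Ventures.GridStability.Lyapunov Summit.Ventures.GridStability.Models
open Literature.Computation.Certificates Literature.Computation.Certificates.SOS

noncomputable section

/-- `sin²u + (1 − cos u)² = 2 − 2cos u ≤ u²` (from `1 − u²/2 ≤ cos u`). [folklore] -/
private theorem sin_sq_add_one_sub_cos_sq_le' (u : ℝ) : sin u ^ 2 + (1 - cos u) ^ 2 ≤ u ^ 2 := by
  nlinarith [sin_sq_add_cos_sq u, Real.one_sub_sq_div_two_le_cos (x := u)]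

/-- The weighted recast ball gauge of a machine state is at most the machine-coordinate gauge:
`Σ(σᵢ² + κᵢ²) + Σωⱼ²/64 ≤ u₂² + u₃² + (ω₁² + ω₂² + ω₃²)/64`. [folklore] -/
theorem deg4_A_sosgram_Dinst_ballsum_Z_le (δs : Fin 3 → ℝ) (x : ClassicalSwing.State 3) :
    deg2_A_SPdampH12_Z δs x 0 ^ 2 + deg2_A_SPdampH12_Z δs x 1 ^ 2 + deg2_A_SPdampH12_Z δs x 2 ^ 2 + deg2_A_SPdampH12_Z δs x 3 ^ 2 +
      deg2_A_SPdampH12_Z δs x 4 ^ 2 / 64 + deg2_A_SPdampH12_Z δs x 5 ^ 2 / 64 + deg2_A_SPdampH12_Z δs x 6 ^ 2 / 64 ≤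
    RecastData.u δs x 1 ^ 2 + RecastData.u δs x 2 ^ 2 + (x.2 0 ^ 2 + x.2 1 ^ 2 + x.2 2 ^ 2) / 64 := by
  rw [deg2_A_SPdampH12_Z_0, deg2_A_SPdampH12_Z_1, deg2_A_SPdampH12_Z_2, deg2_A_SPdampH12_Z_3, deg2_A_SPdampH12_Z_4,
    deg2_A_SPdampH12_Z_5, deg2_A_SPdampH12_Z_6]
  linarith [sin_sq_add_one_sub_cos_sq_le' (RecastData.u δs x 1), sin_sq_add_one_sub_cos_sq_le' (RecastData.u δs x 2)]

/-- **The machine-coordinate ball lies in the certified piece**: `u₂² + u₃² + Σωⱼ²/64 ≤ (241/1000)²` ⇒ `V₄(Z x) ≤ 1159/1000`. [folklore] -/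
theorem deg4_A_sosgram_Dinst_Vz_le_level_of_machine_ball (δs : Fin 3 → ℝ) (x : ClassicalSwing.State 3)
    (hball : RecastData.u δs x 1 ^ 2 + RecastData.u δs x 2 ^ 2 + (x.2 0 ^ 2 + x.2 1 ^ 2 + x.2 2 ^ 2) / 64 ≤ (241 / 1000 : ℝ) ^ 2) :
    deg4_A_sosgram_Dinst_Vz (deg2_A_SPdampH12_Z δs x) ≤ deg4_A_sosgram_Dinst_level := by
  have hM := deg4_A_sosgram_Dinst_Z_mem_M δs x
  have hZ := deg4_A_sosgram_Dinst_ballsum_Z_le δs x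
  show deg4_A_sosgram_Dinst_V (deg2_A_SPdampH12_Z δs x 0) (deg2_A_SPdampH12_Z δs x 1) (deg2_A_SPdampH12_Z δs x 2) (deg2_A_SPdampH12_Z δs x 3) (deg2_A_SPdampH12_Z δs x 4) (deg2_A_SPdampH12_Z δs x 5) (deg2_A_SPdampH12_Z δs x 6) ≤ 1159 / 1000
  exact deg4_A_sosgram_Dinst_V_le_level_of_ball _ _ _ _ _ _ _ hM.1 hM.2 (by linarith)

/-- **«WSCC9-DEG4 BALL» — the ROA sentence from a Euclidean ball of machine states (3-machine WSCC9, deg-4 D-instance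
certificate).** For `δs` with `WSCC9.postB_SPdamp.EqData δs` and every solution `c` of `WSCC9.postB_SPdamp.toModel` on `[0, ∞)` with
`u₂(0)² + u₃(0)² + (ω₁(0)² + ω₂(0)² + ω₃(0)²)/64 ≤ (241/1000)²`: `V₄(Z(c t)) ≤ 1159/1000` for all `t ≥ 0`, no pole slip, `u_i(t) → 0`,
`ω_j(t) → 0`. MODELLED/CERTIFIED columns as in the module docstring. [folklore] -/
theorem deg4_A_sosgram_Dinst_model_roa_ball {δs : Fin 3 → ℝ} (hEq : WSCC9.postB_SPdamp.EqData δs)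
    {c : ℝ → ClassicalSwing.State 3} (hc : WSCC9.postB_SPdamp.toModel.IsSolutionOn c (Ici 0))
    (hball : RecastData.u δs (c 0) 1 ^ 2 + RecastData.u δs (c 0) 2 ^ 2 +
      ((c 0).2 0 ^ 2 + (c 0).2 1 ^ 2 + (c 0).2 2 ^ 2) / 64 ≤ (241 / 1000 : ℝ) ^ 2) :
    (∀ t, 0 ≤ t → deg4_A_sosgram_Dinst_Vz (deg2_A_SPdampH12_Z δs (c t)) ≤ deg4_A_sosgram_Dinst_level) ∧
    (∀ i : Fin 2, ∀ t, 0 ≤ t → |RecastData.u δs (c t) i.succ| < π) ∧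
    (∀ i : Fin 2, Tendsto (fun t ↦ RecastData.u δs (c t) i.succ) atTop (𝓝 0)) ∧
    (∀ j : Fin 3, Tendsto (fun t ↦ (c t).2 j) atTop (𝓝 0)) := by
  have hV := deg4_A_sosgram_Dinst_Vz_le_level_of_machine_ball δs (c 0) hball
  have hsq : 0 ≤ (c 0).2 0 ^ 2 + (c 0).2 1 ^ 2 + (c 0).2 2 ^ 2 := by positivity
  have hwin : ∀ i : Fin 2, |RecastData.u δs (c 0) i.succ| < π := by
    intro i
    have hpi := Real.pi_gt_three
    have hsq1 : RecastData.u δs (c 0) i.succ ^ 2 ≤ 1 := by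
      fin_cases i
      · show RecastData.u δs (c 0) 1 ^ 2 ≤ 1
        nlinarith [sq_nonneg (RecastData.u δs (c 0) 2), hsq]
      · show RecastData.u δs (c 0) 2 ^ 2 ≤ 1
        nlinarith [sq_nonneg (RecastData.u δs (c 0) 1), hsq]
    have h1 := (sq_le_one_iff_abs_le_one _).1 hsq1
    linarith
  have hγ0 : (0 : ℝ) < deg4_A_sosgram_Dinst_level := by
    unfold deg4_A_sosgram_Dinst_level; norm_num
  exact deg4_A_sosgram_Dinst_model_roa hEq hγ0 le_rfl hc hV hwin

end

end Summit.Ventures.GridStability.Bench.WSCC9
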